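import Summits.BirchSwinnertonDyer.BirchSwinnertonDyer.Theorems.SmallImageMuTransferMuTransferX9StepOneSahJoint
import Literature.NumberTheory.EllipticCurves.ModPImageScalarThreeProofs
import HarnessLib

/-!
# Step 1 of the `μ`-transfer core (`stub_coreX9`, crux 19276): (F8) discharged at EVERY ODD PRIME —
# the `p = 3` twin (class X10b = N2) of `…X9StepOneSahX9` / `…X9StepOneSahJoint`

HOME/koly/MU-TRANSFER-PROOF.md (F8)/§5 STEP 1 on the GENUINE objects. The cell's Step-1 conclusion
`LevelE.valueSubgroup_ker_eq_top` ("`im h = 𝒯_{J+1}(E)`", seat `bsd-smallim-k6-c2` g2, p440591) and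
its Sah inputs `exists_homothety_noFixedVector` / `exists_mem_ker_apply_ne_zero` /
`exists_mem_inf_ker_apply_ne_zero` carry `5 ≤ p` — the ONLY place in the Step-0/Step-1 chain where
more than `Irr ∧ ¬Surj` is used, through the central homothety of
`exists_galoisRepTorsion_eq_smul_of_not_surjective` (`5 ≤ p`). MU-TRANSFER-PROOF §7 (ii): at `p = 3`
the same holds on class X10b (`E[3]` irreducible, `ρ̄_{E,3}` NOT surjective, images 3Ns/3Nn) with the
scalar `−1`, a TREE THEOREM (`exists_galoisRepTorsion_eq_smul_of_not_surjective_three`, cell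
`bsd-smallim` koly, p428450). This file (cell `b2b-bsdres`, unit `b2b-bsdres-x10` = N2 class lead,
GEN 37, whose standing question is "where does `3` enter") re-runs the three theorems with
`5 ≤ p` replaced by `p ≠ 2`:

* `exists_galoisRepTorsion_eq_smul_of_ne_two` — the homothety `a ≠ 1` at every odd prime (cases
  `p = 3` / `5 ≤ p` of the two tree theorems; same conclusion verbatim);
* `exists_homothety_noFixedVector_of_ne_two`, `exists_mem_ker_apply_ne_zero_of_ne_two`,
  `valueSubgroup_ker_eq_top_of_ne_two`, `exists_mem_inf_ker_apply_ne_zero_of_ne_two` — the odd-prime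
  forms of the X9 statements, proofs verbatim with the odd-prime homothety.

So STEP 1 (`im h = 𝒯_{J+1}(E)` with no residual hypothesis beyond `κ̄' ≠ 0`) is KERNEL on
`{p odd} × {Irr, ¬Surj}` ⊇ X9 ∪ X10b∧¬Surj: a proof of `stub_coreX9` assembled from these forms ports
to the `p = 3` node `CoreTheoremAOnClassX10b` (x10 GEN 36, `X10/KatoMuTransferThreeOfCore`) unchanged.
Nothing asserted, nothing booked; N2 stays CONSTRUCTION-SHAPED / NEEDS X_A3.

PARTITION (D-0054): X9 (A4) × p ∈ {5,7} and X10b (A5) × p = 3 — helper toward `stub_coreX9` /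
`CoreTheoremAOnClassX10b`; closes none.
-/

set_option linter.dupNamespace false

noncomputable section

open Literature.NumberTheory.EllipticCurves Literature.NumberTheory.GaloisRepresentations Field
  Function

namespace Summit.BirchSwinnertonDyer.BirchSwinnertonDyer.Rank1Residual.LevelE

variable (W : WeierstrassCurve ℚ) [W.IsElliptic] (p : ℕ) [Fact p.Prime] (κ κ' : ZpExtension ℚ p)

/-- **A Galois element acting on `E[p]` by a scalar `a ≠ 1`, at every ODD prime** (MU-TRANSFER-PROOF
(F2)), for `E/ℚ` with `E[p]` irreducible and `ρ̄_{E,p}` NOT surjective: the cases `p = 3`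
(`exists_galoisRepTorsion_eq_smul_of_not_surjective_three`, `a = −1`) and `5 ≤ p`
(`exists_galoisRepTorsion_eq_smul_of_not_surjective`) of the tree, conclusion verbatim. (At `p = 2`
no such element exists: the scalars of `GL₂(𝔽₂)` are trivial.) [cite: Serre1972, §2.4 Prop. 15 and §2.6] -/
theorem exists_galoisRepTorsion_eq_smul_of_ne_two (hp2 : p ≠ 2)
    (hirr : W.HasIrreducibleModPGaloisRep p) (hns : ¬ W.HasSurjectiveModNGaloisRep p) :
    ∃ (σ : absoluteGaloisGroup ℚ) (a : ZMod p), a ≠ 1 ∧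
      ∀ x : WeierstrassCurve.geomTorsion W (p : ℤ),
        Multiplicative.toAdd (WeierstrassCurve.galoisRepTorsion W (p : ℤ) σ) x = a.val • x := by
  by_cases hp3 : p = 3
  · exact W.exists_galoisRepTorsion_eq_smul_of_not_surjective_three p hp3 hirr hns
  · exact W.exists_galoisRepTorsion_eq_smul_of_not_surjective p
      ((Fact.out : p.Prime).five_le_of_ne_two_of_ne_three hp2 hp3) hirr hns

/-- **The central homothety of a non-surjective irreducible image has no fixed vector and is a
scalar on `E[p]`, at every ODD prime**: `∃ z a, (∀ m, z•m = a•m) ∧ (∀ m, z•m = m → m = 0)` — the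
`p ≠ 2` form of `exists_homothety_noFixedVector` (`5 ≤ p`), same proof with the odd-prime homothety.
[cite: Serre1972, §2.4 Prop. 15 and §2.6] [cite: Sah1968, Prop. 2.7 (b)] -/
theorem exists_homothety_noFixedVector_of_ne_two (hp2 : p ≠ 2)
    (hirr : W.HasIrreducibleModPGaloisRep p) (hns : ¬ W.HasSurjectiveModNGaloisRep p) :
    ∃ (z : absoluteGaloisGroup ℚ) (a : ℤ),
      (∀ m : WeierstrassCurve.geomTorsion W (p : ℤ), W.torsionGaloisModule (p : ℤ) z m = a • m) ∧
      (∀ m : WeierstrassCurve.geomTorsion W (p : ℤ),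
        W.torsionGaloisModule (p : ℤ) z m = m → m = 0) := by
  have hp : p.Prime := Fact.out
  obtain ⟨z, a, ha1, hz⟩ := exists_galoisRepTorsion_eq_smul_of_ne_two W p hp2 hirr hns
  have hz' : ∀ m : WeierstrassCurve.geomTorsion W (p : ℤ),
      W.torsionGaloisModule (p : ℤ) z m = (a.val : ℤ) • m := fun m => by
    rw [WeierstrassCurve.torsionGaloisModule_apply_apply, ← WeierstrassCurve.galoisRepTorsion_apply,
      hz m, natCast_zsmul]
  refine ⟨z, (a.val : ℤ), hz', fun m hm => ?_⟩
  have hdvd : ¬ (p : ℤ) ∣ (a.val : ℤ) - 1 := by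
    intro h
    apply ha1
    have h0 : (((a.val : ℤ) - 1 : ℤ) : ZMod p) = 0 := (ZMod.intCast_zmod_eq_zero_iff_dvd _ p).mpr h
    rw [Int.cast_sub, Int.cast_natCast, ZMod.natCast_zmod_val, Int.cast_one, sub_eq_zero] at h0
    exact h0
  exact eq_zero_of_smul_eq_of_prime hp (AddSubgroup.torsionBy.nsmul m) hdvd ((hz' m).symm.trans hm)

/-- **(F8) at every ODD prime: non-zero classes of `E[p]` are non-zero on
`N_J = ker(Γ_ℚ → Aut 𝒯_J(E))`** (Sah with the central homothety; `N_J` open since `E[p]` is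
finite) — the `p ≠ 2` form of `exists_mem_ker_apply_ne_zero`; hypothesis `hSah` of
`valueSubgroup_eq_top_of_towerConst_ne_zero` for `S = N_J` on class X9 AND on class X10b∧¬Surj.
[cite: Sah1968, Prop. 2.7 (b)] [cite: NeukirchSchmidtWingberg2008, (1.6.7)] [cite: Serre1972, §2.4 Prop. 15] -/
theorem exists_mem_ker_apply_ne_zero_of_ne_two (hp2 : p ≠ 2)
    (hirr : W.HasIrreducibleModPGaloisRep p) (hns : ¬ W.HasSurjectiveModNGaloisRep p) (J : ℕ)
    (ψ : contOneCocycles (W.torsionGaloisModule (p : ℤ)).toTopRep)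
    (hψ : oneCocycleClass (W.torsionGaloisModule (p : ℤ)).toTopRep ψ ≠ 0) :
    ∃ τ ∈ (κ.twistModPRepresentation (W.torsionGaloisModule (p : ℤ))
        (fun P : WeierstrassCurve.geomTorsion W (p : ℤ) => AddSubgroup.torsionBy.nsmul P) J).ker,
      ψ.1 τ ≠ 0 := by
  have hp : p.Prime := Fact.out
  haveI : Finite (WeierstrassCurve.geomTorsion W (p : ℤ)) :=
    WeierstrassCurve.finite_torsionPoints_holds W (AlgebraicClosure ℚ) (by exact_mod_cast hp.ne_zero)
  obtain ⟨z, a, hza, hz0⟩ := exists_homothety_noFixedVector_of_ne_two W p hp2 hirr hns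
  exact galoisCohomology.exists_mem_apply_ne_zero_of_isOpen (W.torsionGaloisModule (p : ℤ)) _
    (κ.isOpen_ker_twistModPRepresentation (W.torsionGaloisModule (p : ℤ)) _ J)
    (κ.mk_mem_center_quotient_ker_of_smul (W.torsionGaloisModule (p : ℤ)) _ J hza) hz0 ψ hψ

/-- **STEP 1, `im h = 𝒯_{J+1}(E)` with no residual hypothesis, at every ODD prime** (`p ≠ 2`,
`E[p]` irreducible, `ρ̄_{E,p}` not surjective — class X9 at `p ∈ {5,7}`, class X10b∧¬Surj at
`p = 3`): for `κ' ∈ 𝐇¹_Ω(E[p])` with `κ̄' ≠ 0` and `φ` representing `κ'_{J+1}`, the value group of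
`φ` on `N_{J+1} = ker(Γ_ℚ → Aut 𝒯_{J+1}(E))` is all of `𝒯_{J+1}(E)`. The `p ≠ 2` form of
`valueSubgroup_ker_eq_top`. [cite: Serre1972, §2.4 Prop. 15] [cite: MazurRubin2004, §5.3] [cite: Sah1968, Prop. 2.7 (b)] -/
theorem valueSubgroup_ker_eq_top_of_ne_two (hp2 : p ≠ 2) (hirr : W.HasIrreducibleModPGaloisRep p)
    (hns : ¬ W.HasSurjectiveModNGaloisRep p) {γ : absoluteGaloisGroup ℚ} (hγ : κ.IsTopGenerator γ)
    (y : κ.twistTower (W.torsionGaloisModule (p : ℤ))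
      (fun P : WeierstrassCurve.geomTorsion W (p : ℤ) => AddSubgroup.torsionBy.nsmul P))
    (hy : κ.towerConst (W.torsionGaloisModule (p : ℤ)) (fun P => AddSubgroup.torsionBy.nsmul P) y ≠ 0)
    (J : ℕ) (φ : contOneCocycles (W.modPTwist p κ (J + 1)).toTopRep)
    (hφ : oneCocycleClass (W.modPTwist p κ (J + 1)).toTopRep φ = y.1 (J + 1)) :
    contOneCocycles.valueSubgroup φ
      (κ.twistModPRepresentation (W.torsionGaloisModule (p : ℤ))
        (fun P : WeierstrassCurve.geomTorsion W (p : ℤ) => AddSubgroup.torsionBy.nsmul P) (J + 1)).ker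
      (fun _ hτ x => κ.toTopRep_ρ_apply_eq_self_of_mem_ker (W.torsionGaloisModule (p : ℤ)) _ (J + 1)
        hτ x) = ⊤ :=
  valueSubgroup_eq_top_of_towerConst_ne_zero W p κ hirr hns hγ y hy J φ hφ _ _
    (fun ψ hψ => exists_mem_ker_apply_ne_zero_of_ne_two W p κ hp2 hirr hns (J + 1) ψ hψ)

/-- **(F8) for the pair `(h, h^*)` at every ODD prime**: for `p ≠ 2`, `E[p]` irreducible and `ρ̄` not
surjective, every continuous 1-cocycle of `E[p]` with non-zero class is non-zero on
`N_J(κ) ⊓ N_{J'}(κ')`, the joint kernel of the actions on `𝒯_J(E, κ)` and `𝒯_{J'}(E, κ')` (take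
`κ' = κ.invTwist` for the dual deformation). The `p ≠ 2` form of `exists_mem_inf_ker_apply_ne_zero`.
[cite: Sah1968, Prop. 2.7 (b)] [cite: Serre1972, §2.4 Prop. 15] -/
theorem exists_mem_inf_ker_apply_ne_zero_of_ne_two (hp2 : p ≠ 2)
    (hirr : W.HasIrreducibleModPGaloisRep p) (hns : ¬ W.HasSurjectiveModNGaloisRep p) (J J' : ℕ)
    (ψ : contOneCocycles (W.torsionGaloisModule (p : ℤ)).toTopRep)
    (hψ : oneCocycleClass (W.torsionGaloisModule (p : ℤ)).toTopRep ψ ≠ 0) :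
    ∃ τ ∈ (κ.twistModPRepresentation (W.torsionGaloisModule (p : ℤ))
          (fun P : WeierstrassCurve.geomTorsion W (p : ℤ) => AddSubgroup.torsionBy.nsmul P) J).ker ⊓
        (κ'.twistModPRepresentation (W.torsionGaloisModule (p : ℤ))
          (fun P : WeierstrassCurve.geomTorsion W (p : ℤ) => AddSubgroup.torsionBy.nsmul P) J').ker,
      ψ.1 τ ≠ 0 := by
  have hp : p.Prime := Fact.out
  haveI : Finite (WeierstrassCurve.geomTorsion W (p : ℤ)) :=
    WeierstrassCurve.finite_torsionPoints_holds W (AlgebraicClosure ℚ) (by exact_mod_cast hp.ne_zero)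
  obtain ⟨z, a, hza, hz0⟩ := exists_homothety_noFixedVector_of_ne_two W p hp2 hirr hns
  exact galoisCohomology.exists_mem_apply_ne_zero_of_isOpen (W.torsionGaloisModule (p : ℤ)) _
    ((κ.isOpen_ker_twistModPRepresentation (W.torsionGaloisModule (p : ℤ)) _ J).inter
      (κ'.isOpen_ker_twistModPRepresentation (W.torsionGaloisModule (p : ℤ)) _ J'))
    (mk_mem_center_quotient_inf _ _ z
      (κ.mk_mem_center_quotient_ker_of_smul (W.torsionGaloisModule (p : ℤ)) _ J hza)
      (κ'.mk_mem_center_quotient_ker_of_smul (W.torsionGaloisModule (p : ℤ)) _ J' hza)) hz0 ψ hψ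

/-! ### The `p = 3` (class X10b = N2) instances, in the binder shape of `KatoMuTransferThree` -/

/-- **STEP 1 on class X10b = N2 (`p = 3`, `E[3]` irreducible, `ρ̄_{E,3}` NOT surjective)**:
`im h = 𝒯_{J+1}(E)` with no residual hypothesis beyond `κ̄' ≠ 0` — the instance of
`valueSubgroup_ker_eq_top_of_ne_two` in the binder shape (`p = 3`) of the N2 node
`KatoMuTransferThree` / `CoreTheoremAOnClassX10b`. [cite: Serre1972, §2.6] [cite: Sah1968, Prop. 2.7 (b)] -/
theorem valueSubgroup_ker_eq_top_three (hp3 : p = 3) (hirr : W.HasIrreducibleModPGaloisRep p)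
    (hns : ¬ W.HasSurjectiveModNGaloisRep p) {γ : absoluteGaloisGroup ℚ} (hγ : κ.IsTopGenerator γ)
    (y : κ.twistTower (W.torsionGaloisModule (p : ℤ))
      (fun P : WeierstrassCurve.geomTorsion W (p : ℤ) => AddSubgroup.torsionBy.nsmul P))
    (hy : κ.towerConst (W.torsionGaloisModule (p : ℤ)) (fun P => AddSubgroup.torsionBy.nsmul P) y ≠ 0)
    (J : ℕ) (φ : contOneCocycles (W.modPTwist p κ (J + 1)).toTopRep)
    (hφ : oneCocycleClass (W.modPTwist p κ (J + 1)).toTopRep φ = y.1 (J + 1)) :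
    contOneCocycles.valueSubgroup φ
      (κ.twistModPRepresentation (W.torsionGaloisModule (p : ℤ))
        (fun P : WeierstrassCurve.geomTorsion W (p : ℤ) => AddSubgroup.torsionBy.nsmul P) (J + 1)).ker
      (fun _ hτ x => κ.toTopRep_ρ_apply_eq_self_of_mem_ker (W.torsionGaloisModule (p : ℤ)) _ (J + 1)
        hτ x) = ⊤ :=
  valueSubgroup_ker_eq_top_of_ne_two W p κ (by omega) hirr hns hγ y hy J φ hφ

end Summit.BirchSwinnertonDyer.BirchSwinnertonDyer.Rank1Residual.LevelE

end
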